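import Summits.QuantumFields.BalabanUV.T4Continuum.Spine.NE1p.DressedSmallFieldInnerLabelsRefinedWitness

/-!
# T⁴ programme, spine estimate NE1′ (node O3b/H2) — WITNESS «THE JUNCTION FIRES ON A DECIDED TWO-TORUS DATUM — AND THE REFINEMENT
# COSTS DECAY», PART 2 (LOCATED + GENUINE): for `3 ≤ L` the junction's `hmono` is STRICT on the datum (S47 BY NAME), the datum's label
# is STRICTLY LIGHTER than the same label read on one torus, and S48's bounded quantity is NOT zero

Cell `pub-balaban`, sub-cell `t4`, row NE1′ formalisation crew (`t4/formal/NE1p/LEAVES.md` row W71 ∕ DAG N29zzzz; BOOKED typer gen 8 R-T138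
l.22332; X202 its read), unit `b2b-balaban-t4-ne1p-formalise-leaf-06` (gen 12); PART 2 of 2 (D1) — imports PART 1 `Spine/NE1p/DressedSmallFieldInnerLabelsRefinedWitness` ONLY and re-enters its namespace; THEOREMS
ONLY (0 def, 0 `def … : Prop`, 0 cite, 0 sorry, 0 `attribute`); nothing of PART 1 ∕ S48 ∕ S47 ∕ W50 ∕ W45 ∕ W41 ∕ W35 ∕ W33 ∕ W24 ∕ pv22 restated —
`blk`, `blk_val`, `card_blk`, `lab`, `majR`, `majR_lab`, `majR_lab_le_one`, `majR_pos`, `cR`, `cR_pos`, `GR_apply`, `actR`, `termsR_X₀`, `RR`, `RR_pos`,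
`junctionEnd_fires_closed`, S47's `torusTreeLen_lt_trefine_singleton` ∕ `torusTreeLen_trefine_singleton_ge`, W45's `α₆F`∕`α₆F_pos`∕`δF_mul_κF_pos`,
W41's `termAt_coreW_pencil` ∕ `closedForm_real_sub_zero` ∕ `norm_term_le`, W33's `integral_incr_pos`, W24's `X₀_val` ∕ `dressedConst_le_one` ∕
`exp_locE_cube`, pv22's `torusTreeLen_singleton` are used BY NAME.

* §5 **`hmono_strict`** (`3 ≤ L`: `torusTreeLen X₀.1 < torusTreeLen blk.1` — the typer's strict-refinement test R5 PASSES at `foot := trefineDom`,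
  where every one-torus witness is refuted), `torusTreeLen_blk_pos`, `blk_three` (`L = 3`: `81` cubes, tree length `≥ 65∕64`),
  **`majR_lab_lt_oneTorus`** (the label is STRICTLY LIGHTER than `α₆F·e^{−5RR}` = the same covered label at `foot := id`, W50.1's
  `pI {X₀}` numerically: the refinement COSTS the decay factor `e^{−(δFκF+RR)·d_B} < 1`), `actR_X₀` (one term, W41 BY NAME), `actR_live`,
  `norm_actR_X₀_lt_one`, **`junctionEnd_live`** (W24's `exp_locE_cube` BY NAME), and the closing `example` conjoining bound, liveness,
  strict `hmono` and the decay cost on the same datum (a decided instance).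

HONEST FRAMING.  A DECIDED TOY ([folklore]); as PART 1: one term on one polymer — a vacuity-and-strictness check of S48's junction END;
nothing asserted about Bałaban's densities; `3 ≤ L` is S47's∕pv22's hypothesis letter (print's «L odd > 11» TYPE only); 0 binders
instantiated on Bałaban's densities; no wall item; wall v1.8 (T4-DAG v48) does NOT move; R-t4r2-Q2 NOT met; NE1′ ⇐ the named binders —
NOT proved, NOT printed; spine PROVED 0∕9; count 9 unchanged.  Rung (B)+1 on ONE finite four-torus — NOT infinite volume, NOT a mass gap,
NOT OS on ℝ⁴, NOT Clay.
HONEST DEPENDENCY: continuum YM on T⁴ ⇐ BetaPertH ∧ nine spine estimates (0/9 proved); BetaPertH ⇐ (D1) ∧ (D4) ∧ CAP+tail; G-an2-4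
gates asym, D1 and NE2/3/4.
-/

noncomputable section

namespace Summit.QuantumFields.BalabanUV.T4Continuum.NE1p.DressedSmallFieldInnerLabelsRefinedWitness

open Set Metric MeasureTheory Complex
open scoped BigOperators
open Literature.MathematicalPhysics.QuantumFieldTheory.Balaban1983to89
open Literature.MathematicalPhysics.QuantumFieldTheory.Balaban1983to89.B12TreeDecay (K₀ K₀_pos)
open Literature.MathematicalPhysics.QuantumFieldTheory.Balaban1983to89.B13Resummation (locE)
open Literature.MathematicalPhysics.QuantumFieldTheory.Balaban1983to89.TreeLengthTorus (TPt TDom tsys torusTreeLen torusTreeLen_singleton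
  torusTreeLen_nonneg)
open Literature.MathematicalPhysics.QuantumFieldTheory.Balaban1983to89.TreeLengthTorusGeometry (tgeometry TTouch)
open Summit.QuantumFields.BalabanUV.T4Continuum.B13HistMeasurable (B13HistM)
open Summit.QuantumFields.BalabanUV.T4Continuum.B13HistWitness (toyFrame)
open Summit.QuantumFields.BalabanUV.T4Continuum.TorusBlockRefinementCard (torusTreeLen_lt_trefine_singleton torusTreeLen_trefine_singleton_ge)
open Summit.QuantumFields.BalabanUV.T4Continuum.NE1p.DressedSmallFieldTorusWitness (X₀ X₀_val dressedConst_le_one exp_locE_cube)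
open Summit.QuantumFields.BalabanUV.T4Continuum.NE1p.DressedSmallFieldCoresWitness (E1 crd liveTable Acst Acst_pos incr integral_incr_pos)
open Summit.QuantumFields.BalabanUV.T4Continuum.NE1p.DressedSmallFieldCoresMassWitness (cM cM_pos)
open Summit.QuantumFields.BalabanUV.T4Continuum.NE1p.DressedSmallFieldDepCoresWitness (termAt_coreW_pencil closedForm_real_sub_zero norm_term_le)
open Summit.QuantumFields.BalabanUV.T4Continuum.NE1p.DressedSmallFieldFamiliesWitness (δF κF α₆F α₆F_pos δF_mul_κF_pos)

section Torus
variable (N : ℕ) [NeZero N] (L : ℕ) [NeZero L]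

variable (r : ℝ) (hr : 0 ≤ r)

/-! ## §5 LOCATED ∕ GENUINE: the junction's `hmono` is STRICT on the datum, the refinement COSTS decay, the END's quantity is NOT zero -/

/-- **THE JUNCTION's `hmono` IS STRICT ON THE DATUM** [located, kernel]: for `3 ≤ L` the coarse unit cube has tree length `0` and its
refined block has POSITIVE tree length — S47's `torusTreeLen_lt_trefine_singleton` BY NAME (the typer's strict-refinement test R5
PASSES at `foot := trefineDom`, where every one-torus witness is refuted). [folklore] -/
theorem hmono_strict (hL : 3 ≤ L) : torusTreeLen (X₀ N).1 < torusTreeLen (blk N L).1 := by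
  rw [blk_val, X₀_val]; exact torusTreeLen_lt_trefine_singleton hL (by norm_num) 0

/-- The fine tree length of the datum is positive for `3 ≤ L`. [folklore] -/
theorem torusTreeLen_blk_pos (hL : 3 ≤ L) : 0 < torusTreeLen (blk N L).1 := by
  have h := hmono_strict N L hL; rwa [X₀_val, torusTreeLen_singleton] at h

/-- At `L = 3`: the refined unit block has `81` cubes and tree length `≥ 65∕64` (S47 BY NAME). [arith] -/
theorem blk_three : (blk N 3).1.card = 81 ∧ (65 / 64 : ℝ) ≤ torusTreeLen (blk N 3).1 := by
  refine ⟨by rw [card_blk]; norm_num, ?_⟩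
  rw [blk_val]
  have h := torusTreeLen_trefine_singleton_ge (L := 3) (N' := N) (d := 4) 0
  norm_num at h
  linarith

/-- **THE REFINEMENT COSTS DECAY** [located, kernel]: for `3 ≤ L` the datum's label is STRICTLY LIGHTER than the SAME covered label read on
one torus (`foot := id`: `α₆F·e^{−δFκF·0}·e^{−RR(0+5)} = α₆F·e^{−5RR}`, W50.1's covered weight at the unit cube) — by the factor
`e^{−(δFκF+RR)·d_B} < 1`. [folklore] -/
theorem majR_lab_lt_oneTorus (hL : 3 ≤ L) : majR N L (lab N L) < α₆F * Real.exp (-(RR * 5)) := by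
  rw [majR_lab]
  have hd := torusTreeLen_blk_pos N L hL
  have hα := α₆F_pos
  have h1 : Real.exp (-(δF * κF * torusTreeLen (blk N L).1)) < 1 :=
    Real.exp_lt_one_iff.2 (neg_neg_iff_pos.2 (mul_pos δF_mul_κF_pos hd))
  have h2 : Real.exp (-(RR * (torusTreeLen (blk N L).1 + 5))) < Real.exp (-(RR * 5)) :=
    Real.exp_lt_exp.2 (by nlinarith [RR_pos])
  calc α₆F * Real.exp (-(δF * κF * torusTreeLen (blk N L).1)) * Real.exp (-(RR * (torusTreeLen (blk N L).1 + 5)))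
      < α₆F * 1 * Real.exp (-(RR * (torusTreeLen (blk N L).1 + 5))) := by gcongr
    _ < α₆F * 1 * Real.exp (-(RR * 5)) := by gcongr
    _ = α₆F * Real.exp (-(RR * 5)) := by ring

open Classical in
/-- **THE ACTIVITY AT `X₀` IN CLOSED FORM**: ONE term — W33's core at the weight `cR lab` (W41's `termAt_coreW_pencil` BY NAME). [folklore] -/
theorem actR_X₀ (k : ℕ) (s : ℂ) :
    actR N L r hr k s (X₀ N) =
      ((cR N L r (lab N L) : ℝ) : ℂ) * ∫ v : E1, cexp (s * ((r : ℂ) * (Real.exp (-(crd v ^ 2)) : ℂ))) * cexp (-(((‖v‖ ^ 2 : ℝ) : ℂ))) := by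
  unfold actR; rw [termsR_X₀, Finset.sum_singleton, GR_apply, termAt_coreW_pencil]

/-- **THE ATTACHED PART OF THE ACTIVITY IS NOT ZERO** (`cR lab > 0`, W33's `∫ incr r > 0` for `0 < r`). [folklore] -/
theorem actR_live (hr0 : 0 < r) (k : ℕ) : actR N L r hr k 1 (X₀ N) ≠ actR N L r hr k 0 (X₀ N) := by
  intro h
  have h0 := sub_eq_zero.2 h
  rw [actR_X₀, actR_X₀, show (1 : ℂ) = ((1 : ℝ) : ℂ) from Complex.ofReal_one.symm, closedForm_real_sub_zero _ r hr 1, one_mul] at h0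
  rcases mul_eq_zero.1 h0 with hc | hI
  · exact (cR_pos N L r (lab N L)).ne' (by exact_mod_cast hc)
  · exact (integral_incr_pos r hr0).ne' (by exact_mod_cast hI)

/-- The activities at `X₀` lie STRICTLY inside the unit disc for `‖s‖ ≤ 2` (`majR lab ≤ 1`, W41's `norm_term_le`, `A ≤ 1`). [folklore] -/
theorem norm_actR_X₀_lt_one (k : ℕ) {s : ℂ} (hs : ‖s‖ ≤ 2) : ‖actR N L r hr k s (X₀ N)‖ < 1 := by
  rw [actR_X₀]
  have hp0 : 0 ≤ majR N L (lab N L) := (majR_pos N L _).le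
  have hp1 := majR_lab_le_one N L
  have hπ : 0 < Real.sqrt Real.pi := Real.sqrt_pos.2 Real.pi_pos
  have hlt : Real.sqrt Real.pi < Real.sqrt (2 * Real.pi) := Real.sqrt_lt_sqrt Real.pi_pos.le (by linarith [Real.pi_pos])
  have hq : Real.sqrt Real.pi / Real.sqrt (2 * Real.pi) < 1 := (div_lt_one (hπ.trans hlt)).2 hlt
  have hA : Acst ≤ 1 := dressedConst_le_one
  have hb := norm_term_le r hr hs
  have hn : ‖((cR N L r (lab N L) : ℝ) : ℂ) * ∫ v : E1, cexp (s * ((r : ℂ) * (Real.exp (-(crd v ^ 2)) : ℂ))) *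
        cexp (-(((‖v‖ ^ 2 : ℝ) : ℂ)))‖ =
      majR N L (lab N L) * ‖((cM r / 2 : ℝ) : ℂ) * ∫ v : E1, cexp (s * ((r : ℂ) * (Real.exp (-(crd v ^ 2)) : ℂ))) *
        cexp (-(((‖v‖ ^ 2 : ℝ) : ℂ)))‖ := by
    unfold cR
    rw [norm_mul, norm_mul, Complex.norm_real, Complex.norm_real, Real.norm_eq_abs, Real.norm_eq_abs, abs_mul, abs_of_nonneg hp0]
    ring
  rw [hn]
  calc majR N L (lab N L) * ‖((cM r / 2 : ℝ) : ℂ) * ∫ v : E1, cexp (s * ((r : ℂ) * (Real.exp (-(crd v ^ 2)) : ℂ))) *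
          cexp (-(((‖v‖ ^ 2 : ℝ) : ℂ)))‖
      ≤ 1 * (Acst / 2 * (Real.sqrt Real.pi / Real.sqrt (2 * Real.pi))) := mul_le_mul hp1 hb (norm_nonneg _) zero_le_one
    _ < 1 := by
        rw [one_mul]
        have := Acst_pos
        nlinarith

open Classical in
/-- **THE JUNCTION's BOUNDED QUANTITY IS NOT ZERO** [decided toy]: equal dressed outputs on the cube would give equal activities at `X₀`
(W24's `exp_locE_cube` BY NAME), contradicting `actR_live`. [folklore] -/
theorem junctionEnd_live (hr0 : 0 < r) (k : ℕ) :
    locE (TTouch (d := 4) (N := N)) (fun Z : (tsys 4 N).Dom => Z.1) (actR N L r hr k 1) (X₀ N).1 ≠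
      locE (TTouch (d := 4) (N := N)) (fun Z : (tsys 4 N).Dom => Z.1) (actR N L r hr k 0) (X₀ N).1 := by
  intro h
  have h1 := exp_locE_cube N (w := actR N L r hr k 1) (norm_actR_X₀_lt_one N L r hr k (by simp))
  have h0 := exp_locE_cube N (w := actR N L r hr k 0) (norm_actR_X₀_lt_one N L r hr k (by simp))
  rw [X₀_val] at h
  have h' := congrArg cexp h
  rw [h1, h0, add_right_inj] at h'
  exact actR_live N L r hr hr0 k h'

open Classical in
/-- **THE JUNCTION FIRES ON A LIVE, STRICTLY-REFINED DATUM** (`3 ≤ L`): S48's bound holds, its quantity is not zero, `hmono` is strict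
and the refinement costs decay — all four on the same datum. [folklore] -/
example (hL : 3 ≤ L) (hr0 : 0 < r) (k : ℕ) :
    ‖locE (TTouch (d := 4) (N := N)) (fun Z : (tsys 4 N).Dom => Z.1) (actR N L r hr k 1) (X₀ N).1 -
          locE (TTouch (d := 4) (N := N)) (fun Z : (tsys 4 N).Dom => Z.1) (actR N L r hr k 0) (X₀ N).1‖ ≤ K₀ 64 8 ∧
      locE (TTouch (d := 4) (N := N)) (fun Z : (tsys 4 N).Dom => Z.1) (actR N L r hr k 1) (X₀ N).1 ≠
        locE (TTouch (d := 4) (N := N)) (fun Z : (tsys 4 N).Dom => Z.1) (actR N L r hr k 0) (X₀ N).1 ∧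
      torusTreeLen (X₀ N).1 < torusTreeLen (blk N L).1 ∧ majR N L (lab N L) < α₆F * Real.exp (-(RR * 5)) :=
  ⟨junctionEnd_fires_closed N L r hr k, junctionEnd_live N L r hr hr0 k, hmono_strict N L hL, majR_lab_lt_oneTorus N L hL⟩

end Torus

end Summit.QuantumFields.BalabanUV.T4Continuum.NE1p.DressedSmallFieldInnerLabelsRefinedWitness

end
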